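import Summits.AtomisticToContinuum.BoseEinsteinCondensation.Theorems.BECGroundStateSOSPeriodicIRBoundTwoSectorPairDefs
import Summits.AtomisticToContinuum.BoseEinsteinCondensation.Theorems.BECGroundStateSOSPeriodicIRBoundTwoSectorWindowTLow
import HarnessLib

/-!
# Route `BECGroundStateSOS`, crux `PeriodicIRBound` (stmt-AtomisticToContinuum-3972), line `two-sector-gd-transfer`
# (v11 "pointwise floating + soft location") — stub S5₁ `stub_windowAssemblyPair : WindowAssemblyPair`

Supports (does not close) stmt-AtomisticToContinuum-3972. The registered stub S5₁ of the v11 skeleton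
`Cruxes/PeriodicIRBound/Lines/two_sector_gd_transfer.lean` (statement `WindowAssemblyPair` in
`Theorems/BECGroundStateSOSPeriodicIRBoundTwoSectorPairDefs.lean`): for ONE integrable admissible potential `v` and
`κ, ρ₀, C > 0`, `A ≥ 0`, the PER-STATE floating two-channel bound `FloatingPairLow v (2πκ) ρ₀ C A` (for every `ε > 0`
and `ρ < ρ₀`, eventually in `N = m + 2` along `L = L_N(ρ)`, at every mode `0 < 2π‖n‖_∞/L ≤ 2πκ√ρ` the pair of
momentum-zero channel inequalities `ChanPairZero` holds with bound `b = CL²/‖n‖²_∞`, guard `−Aρ ≤ μ₊` and coupling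
`μ₋ ≤ μ₊ + ε√(ρa)/L`, the chemical potentials `μ₊, μ₋` being chosen AFTER the near-minimiser) and the per-state
Kennedy–Lieb–Shastry moment inequality on momentum-zero near-minimisers `KLSMomentPair v` give `IRBoundZeroWith v κ ρ₀ C'`
with `C' := C√a + 2κ + √((12π²C + 1)κ² + 2C(‖v‖₁ + A/2))` (`a` the scattering length, `‖v‖₁ = ∫ v(|x|)dx`) — the
crux's infrared inequality on momentum-zero near-minimisers, with NO shrinking of `ρ₀`.

Proof: the landed S5₀ proof `stub_windowAssemblyTLow` (p160319, `…TwoSectorWindowTLow.lean`) verbatim, with the single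
change that `μ₊, μ₋` are obtained per state from the conclusion of `KLSMomentPair` (after the slack `δ(n)` has been fixed
and the near-minimiser `Ψ` is given) instead of per mode from `FloatingForLow`. For `ρ < ρ₀` a window mode
`0 < ‖n‖_∞ ≤ κ√ρL` has `2π‖n‖_∞/L ≤ 2πκ√ρ`, the low window of `FloatingPairLow` at `K = 2πκ`; so (at `ε = 1`, eventually
in `m`) it supplies `ChanPairZero` at `b = CL²/‖n‖²`, guard `Aρ`, coupling `√(ρa)/L`; `E₀(N, L) < ⊤` for integrable `v`
(`ZeroMomentumGround.periodicGroundStateEnergy_ne_top_of_lintegral_ne_top`), and `KLSMomentPair` at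
`η_n := min 1 (‖n‖²/(CL²))` (so `bη_n ≤ 1`) yields a slack `δ(n) > 0`; the slack `δ_N` is the least `δ(n)` over the finite
box containing the window (`Negative.inWindow_mem_box`). For a momentum-zero `δ_N`-near-minimiser `Ψ` the moment
inequality comes with its own `μ₊ ≥ −Aρ`, `μ₋ ≤ μ₊ + √(ρa)/L`, and its energy combination is
`E₀(2n_k+1) − (E₀ − μ₋)n_k − (E₀ + μ₊)(n_k+1) = (μ₋ − μ₊)n_k − μ₊ ≤ n_k·√(ρa)/L + Aρ`, handled by the landed relaxed-guard
endgame `WindowArithLow.nk_le` (slack `t := Aρ`, f-sum constant `V₁ + A/2`, using `|2πn/L|² ≤ 12π²‖n‖²_∞/L²`,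
`TransferArith.norm_latticeVec_eq`, `L³ = N/ρ`): `n_k ≤ C'·√ρL/‖n‖`. Elementary (real/`ℝ≥0∞` arithmetic and filters);
nothing is cited as a fact. References for the shape only: T. Kennedy, E. H. Lieb, B. S. Shastry, J. Stat. Phys. 53
(1988) 1019, (12)–(14).
-/

noncomputable section

open scoped BigOperators ENNReal
open Filter MeasureTheory

namespace Summit.AtomisticToContinuum.BoseEinsteinCondensation.Cruxes.PeriodicIRBound.TwoSectorGdTransfer

open Literature.MathematicalPhysics.QuantumManyBody.BoseGas
open Summit.AtomisticToContinuum.BoseEinsteinCondensation.Theorems.PeriodicIRBound.Negative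
  (IRBoundFor NearMin InWindow IRIneq irIneq_iff inWindow_mem_box sqrt_nsq_le_sqrt_three_mul_norm)
open Summit.AtomisticToContinuum.BoseEinsteinCondensation.Theorems.GaussianDominationCan.Negative
  (nsq nsq_nonneg one_le_norm_intVec)
open Summit.AtomisticToContinuum.BoseEinsteinCondensation.Cruxes.PeriodicIRBound.LinearPhFloorWagner
  (TransferArith.norm_latticeVec_eq)
open Summit.AtomisticToContinuum.BoseEinsteinCondensation.Theorems.ZeroMomentumGround
  (periodicGroundStateEnergy_ne_top_of_lintegral_ne_top)

/-! ### The stub -/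

/-- **Stub S5₁ — window arithmetic and the scalar endgame on momentum-zero states, per-state chemical potentials.** For
an integrable admissible `v` and `κ, ρ₀, C > 0`, `A ≥ 0`, the per-state floating two-channel bound
`FloatingPairLow v (2πκ) ρ₀ C A` and the per-state KLS moment inequality on momentum-zero near-minimisers `KLSMomentPair v`
give `IRBoundZeroWith v κ ρ₀ C'` with `C' = C√a + 2κ + √((12π²C+1)κ² + 2C(‖v‖₁ + A/2))`: for densities below `ρ₀` (no
shrinking), eventually in `N` the least KLS slack over the finite momentum window works; the chemical potentials `μ₊, μ₋`
delivered with each near-minimiser enter only the scalar endgame `WindowArithLow.nk_le` (see the module docstring for the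
proof). [folklore] -/
theorem stub_windowAssemblyPair : WindowAssemblyPair := by
  intro v hv hint κ ρ₀ C A hκ hρ₀ hC hA hF hKLS
  set V₁ : ℝ := (∫⁻ x : Space, v ‖x‖).toReal with hV₁def
  set a : ℝ := (scatteringLength v).toReal with hadef
  have hV₁ : 0 ≤ V₁ := ENNReal.toReal_nonneg
  have hV₁' : 0 ≤ V₁ + A / 2 := by positivity
  refine ⟨C * Real.sqrt a + 2 * κ + Real.sqrt ((12 * Real.pi ^ 2 * C + 1) * κ ^ 2 + 2 * C * (V₁ + A / 2)),
    by positivity, fun ρ hρ hρ₀' => ?_⟩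
  set C' : ℝ := C * Real.sqrt a + 2 * κ + Real.sqrt ((12 * Real.pi ^ 2 * C + 1) * κ ^ 2 + 2 * C * (V₁ + A / 2))
    with hC'
  -- the per-state floating two-channel bound at `ε = 1`, eventually in `m`, read eventually in `N = m + 2`
  obtain ⟨m₀, hm₀⟩ := eventually_atTop.1 (hF 1 one_pos ρ hρ hρ₀')
  refine eventually_atTop.2 ⟨m₀ + 2, fun N hN => ?_⟩
  obtain ⟨m, rfl⟩ : ∃ m, N = m + 2 := ⟨N - 2, by omega⟩
  have hFm := hm₀ m (by omega)
  -- notation and side conditions along `L = L_N(ρ)`, `L³ = N/ρ`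
  have hL : 0 < sideLength ρ (m + 2) := sideLength_pos_of_pos hρ (by omega)
  have hL3 : sideLength ρ (m + 2) ^ 3 = ((m + 2 : ℕ) : ℝ) / ρ := sideLength_pow_three hρ (m + 2)
  set L := sideLength ρ (m + 2) with hLdef
  have hfin : ∀ M : ℕ, periodicGroundStateEnergy v M L ≠ ⊤ := fun M =>
    periodicGroundStateEnergy_ne_top_of_lintegral_ne_top hv.1 hint M hL
  have he0 : 0 ≤ 1 * Real.sqrt (ρ * a) / L := by positivity
  have he : 1 * Real.sqrt (ρ * a) / L ≤ Real.sqrt ρ * Real.sqrt a / L := by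
    rw [one_mul, Real.sqrt_mul hρ.le]
  have hAρ : 0 ≤ A * ρ := mul_nonneg hA hρ.le
  -- a slack for each mode of the window
  have hk : ∀ n : Fin 3 → ℤ, ∃ δ : ℝ≥0∞, 0 < δ ∧ (InWindow κ ρ (m + 2) n →
      ∀ Ψ : PeriodicTrialState (m + 2) L, NearMinAt v δ Ψ → HasTotalMomentum 0 Ψ.ψ →
        IRIneq C' ρ (m + 2) Ψ.ψ n) := by
    intro n
    by_cases hnw : InWindow κ ρ (m + 2) n
    · have hn1 : 1 ≤ ‖(fun j => (n j : ℝ))‖ := one_le_norm_intVec hnw.1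
      have hnL : ‖(fun j => (n j : ℝ))‖ ≤ κ * Real.sqrt ρ * L := hnw.2
      set nn : ℝ := ‖(fun j => (n j : ℝ))‖ with hnn
      have hn0 : 0 < nn := one_pos.trans_le hn1
      have hc : 0 < 2 * Real.pi / L := by positivity
      -- the crux window is exactly the low window of `FloatingPairLow` at `K = 2πκ`
      have hnK : 2 * Real.pi / L * nn ≤ 2 * Real.pi * κ * Real.sqrt ρ := by
        calc 2 * Real.pi / L * nn ≤ 2 * Real.pi / L * (κ * Real.sqrt ρ * L) :=
              mul_le_mul_of_nonneg_left hnL hc.le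
          _ = 2 * Real.pi * κ * Real.sqrt ρ := by field_simp
      have hb : 0 ≤ C * L ^ 2 / nn ^ 2 := by positivity
      -- the per-state pair of channel inequalities at this mode (guard `Aρ`, coupling `√(ρa)/L`)
      have hPair := hFm n hnw.1 hnK
      have hη : 0 < min 1 (nn ^ 2 / (C * L ^ 2)) := lt_min one_pos (by positivity)
      obtain ⟨δ, hδ, hδspec⟩ := hKLS m L hL (hfin _) n hnw.1 _ _ _ hb hPair _ hη
      refine ⟨δ, hδ, fun _ Ψ hΨ h0 => ?_⟩
      have hocc : cellOccupation (m + 2) L (planeWaveMode L n) Ψ.ψ ≠ ⊤ :=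
        ne_top_of_le_ne_top (ENNReal.natCast_ne_top _) (Ψ.cellOccupation_planeWaveMode_le hL n)
      have hbη : C * L ^ 2 / nn ^ 2 * min 1 (nn ^ 2 / (C * L ^ 2)) ≤ 1 := by
        calc C * L ^ 2 / nn ^ 2 * min 1 (nn ^ 2 / (C * L ^ 2))
            ≤ C * L ^ 2 / nn ^ 2 * (nn ^ 2 / (C * L ^ 2)) := mul_le_mul_of_nonneg_left (min_le_right _ _) hb
          _ = 1 := by field_simp
      have hD0 : 0 ≤ ‖latticeVec (2 * Real.pi / L) n‖ ^ 2 + (2 * ((m : ℝ) + 2) * V₁ / L ^ 3 + A * ρ) := by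
        positivity
      -- the f-sum bound with the slack `Aρ` absorbed: `D + Aρ ≤ 12π²‖n‖²/L² + 2ρ(‖v‖₁ + A/2)`
      have hD : ‖latticeVec (2 * Real.pi / L) n‖ ^ 2 + (2 * ((m : ℝ) + 2) * V₁ / L ^ 3 + A * ρ) ≤
          12 * Real.pi ^ 2 * nn ^ 2 / L ^ 2 + 2 * ρ * (V₁ + A / 2) := by
        have h1 : ‖latticeVec (2 * Real.pi / L) n‖ ^ 2 ≤ 12 * Real.pi ^ 2 * nn ^ 2 / L ^ 2 := by
          rw [TransferArith.norm_latticeVec_eq, abs_of_pos hc]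
          have h3 : Real.sqrt (nsq n) ≤ Real.sqrt 3 * nn := sqrt_nsq_le_sqrt_three_mul_norm n
          calc (2 * Real.pi / L * Real.sqrt (nsq n)) ^ 2 ≤ (2 * Real.pi / L * (Real.sqrt 3 * nn)) ^ 2 :=
                pow_le_pow_left₀ (by positivity) (mul_le_mul_of_nonneg_left h3 hc.le) 2
            _ = 12 * Real.pi ^ 2 * nn ^ 2 / L ^ 2 := by
                rw [mul_pow, mul_pow, Real.sq_sqrt (by norm_num : (0 : ℝ) ≤ 3)]
                field_simp
                ring
        have h2 : 2 * ((m : ℝ) + 2) * V₁ / L ^ 3 = 2 * ρ * V₁ := by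
          have hm : (m : ℝ) + 2 ≠ 0 := by positivity
          rw [hL3]
          push_cast
          field_simp
        have h4 : 2 * ρ * (V₁ + A / 2) = 2 * ρ * V₁ + A * ρ := by ring
        linarith
      -- the moment inequality of this near-minimiser, with ITS chemical potentials `μ₊ ≥ -Aρ`, `μ₋ ≤ μ₊ + √(ρa)/L`
      have hkls0 := hδspec Ψ hΨ h0
      simp only at hkls0
      obtain ⟨μp, μm, hμp, hμm, hkls⟩ := hkls0
      rw [← hV₁def] at hkls
      -- the relaxed guard replaces monotonicity; the coupling slack replaces midpoint near-convexity
      have hμm' : μm ≤ μp + 1 * Real.sqrt (ρ * a) / L := hμm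
      have hmono : (periodicGroundStateEnergy v (m + 2) L).toReal ≤
          (periodicGroundStateEnergy v (m + 2) L).toReal + μp + A * ρ := by linarith
      have hconvR : 2 * (periodicGroundStateEnergy v (m + 2) L).toReal ≤
          ((periodicGroundStateEnergy v (m + 2) L).toReal + μp) +
            ((periodicGroundStateEnergy v (m + 2) L).toReal - μm) + 1 * Real.sqrt (ρ * a) / L := by
        linarith
      have key := WindowArithLow.nk_le hC hκ hρ hL hn1 hnL hV₁' hη.le (min_le_left _ _) hbη hD0 hD
        ENNReal.toReal_nonneg he0 he hmono hconvR hkls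
      rw [irIneq_iff]
      exact (ENNReal.ofReal_toReal hocc).symm.le.trans (ENNReal.ofReal_le_ofReal key)
    · exact ⟨1, one_pos, fun h => (hnw h).elim⟩
  choose δf hδf hprop using hk
  -- the least slack over the finite box containing the window
  set W : Finset (Fin 3 → ℤ) := Fintype.piFinset fun _ : Fin 3 =>
      Finset.Icc (-((⌈κ * Real.sqrt ρ * L⌉₊ : ℕ) : ℤ)) ((⌈κ * Real.sqrt ρ * L⌉₊ : ℕ) : ℤ) with hW
  have hW0 : (0 : Fin 3 → ℤ) ∈ W := by
    rw [hW, Fintype.mem_piFinset]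
    intro j
    simp
  have hWne : W.Nonempty := ⟨0, hW0⟩
  refine ⟨W.inf' hWne δf, (Finset.lt_inf'_iff hWne).2 fun k _ => hδf k, fun Ψ hΨ h0 k hkw => ?_⟩
  have hmem : k ∈ W := inWindow_mem_box hkw
  exact hprop k hkw Ψ (hΨ.trans (add_le_add le_rfl (Finset.inf'_le _ hmem))) h0

end Summit.AtomisticToContinuum.BoseEinsteinCondensation.Cruxes.PeriodicIRBound.TwoSectorGdTransfer

end
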